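import Summits.ABC.IUTFork.Cor312ThetaFinitePrVol
import Summits.ABC.IUTFork.Cor312PilotIdelesPr
import Summits.ABC.IUTFork.Cor312PilotIdelesPrNumbers
import Summits.ABC.IUTFork.Cor312PilotIdelesCapstone
import HarnessLib

/-!
# [IUTchIII] Corollary 3.12 at the PRINT-NORMALISED assembled real setting with the Dupuy–Hilado pilot regions read
# off ideles — CAPSTONE: `ThetaFinite` and `BridgeHyps` UNCONDITIONALLY, `ThetaRegionsAdm`, `Statement ⟸
# GlobalVolumeTransport`, `−|log(q)| = −deĝ(P_q) = −(1/2l)·log(q)`, and `Statement ↔ (−deĝ(P_q) ≤ −|log(Θ)|)`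

PROOF-ONLY record file (D-0012; no definitions) of the abc-iut cell (Cor. 3.12 sub-crew, seat abc-iut-c312-7, gen 3;
D-0067 TEAM A row A-0 coda «A-0 AT THE PRINT-NORMALISED SETTING»); TAKES NO SIDE. Assembles this seat's
`Cor312ThetaFinitePrVol` (p421738), `Cor312PilotIdelesPr` (p422627: `settingPrVolSharp`), `Cor312PilotIdelesPrNumbers`
(p423787: the `q`-number) with abc-iut-c312-3 (gen 4)'s WEIGHT-FREE set-level facts about the sharp boxes
(`Cor312PilotIdelesCapstone` p420764: `isHullSet_thetaBoxDH_sharp`, `finite_ne_unitBox_sharp`, `iUnion_thetaBoxDH_sharp`) and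
abc-iut-c312-6 (gen 4)'s `BridgeHyps`-free volume vehicles (`Cor312VolumeVehiclesMono`: `statement_of_globalVolumeTransport_of_mono`,
`thetaRegionsAdm_ofComparison_of_isHullSet`), for abc-iut-c312-1 (gen 5)'s packet-normalised container (`Cor312SettingPrVol`
p419741; finding F-c312-1-g5-1) — i.e. the print-normalised twin of abc-iut-c312-3's `Cor312PilotIdelesCapstone`:

* §1 at `settingPrVol` (any Θ-box / `q`-centre binders): `logvolMono_settingPrVol`, `thetaRegionsAdm_settingPrVol_of_isHullSet`,
  `statement_settingPrVol_of_globalVolumeTransport` / `_of_volumeTransport` (the printed Statement ⟸ {hull-set Θ-boxes,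
  `ThetaFinite`, TEAM B's gap input `GlobalVolumeTransport` (G-c312-11-1, kurims `paper:url-4b091feeb646` p. 184
  l. 30–34) — NOT asserted});
* §2 at `settingPrVolSharp` (pilot regions from ideles `t`, `tq`: non-zero, units off `S`):
  **`thetaFinite_settingPrVolSharp`** ("`−|log(Θ)| ∈ ℝ`", Cor. 3.12 p. 174 l. 16, PROVED: the sharp box is the hull-set
  `λ_Θ·𝒪_L`, bounded and nondegenerate, `= 𝒪_L` off the primes under `S`), **`bridgeHyps_settingPrVolSharp_of_ideles`**
  (EVERY field of abc-iut-c312-6's `BridgeHyps` a theorem — no residual beyond the idele binders),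
  `thetaRegionsAdm_settingPrVolSharp`, `statement_settingPrVolSharp_of_globalVolumeTransport`;
* §3 the numbers: **`negLogQ_settingPrVolSharp`** `= −FinDivisor.ndeg F X.qPilot` for `q`-ideles realising `P_q` (DH (3.4)),
  `negLogQ_settingPrVolSharp_eq_neg_absLogq` `= −(1/2l)·log(q)` of `D` under `IsPilotDataOf D X` ([IUTchIV] Thm. 1.10
  p. 23 l. 27–30), `absLogQPos_settingPrVolSharp`; and the residue of the printed Statement at this setting:
  **`statement_settingPrVolSharp_iff`**: `Statement ↔ ↑(−deĝ(P_q)) ≤ −|log(Θ)|` — the first conjunct is a theorem, the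
  `q`-side is a NUMBER, what remains is exactly the disputed Θ-side inequality (the cell's adjudication question,
  plan/ADJUDICATION-SPEC; Teams A/B/C/R) — NOT asserted, NOT denied.
[claim: Mochizuki2012, status: disputed] for the quoted sentences; [cite: DupuyHilado2025, §3.4, §3.6, §3.9, Thm. 3.10.1];
[cite: Mochizuki2012, IUTchIII Rmk. 3.9.5 (ix) p. 128, IUTchIV Thm. 1.10 p. 23]. HONEST FRAMING: side conditions and
one number at one instantiation; whether `GlobalVolumeTransport` (or the inequality) follows from [IUTchIII] Thm. 3.11 is
untouched; realising Θ-ideles exist iff `2l ∣ ord_v(q_v)` on `S` (abc-iut-c312-3 `exists_realising_thetaIdeles`, recorded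
not assumed). An instance ≠ an endorsement; typed ≠ proved.
-/

noncomputable section

open Set Function NumberField IsDedekindDomain
open scoped Pointwise

namespace Summit.ABC

namespace IUTFork

namespace Thm311

namespace Real

open Cor312 Cor312Vol Literature.IUT.LogThetaLattice Literature.IUT.LogVolume Literature.IUT.HodgeTheaters

variable {F : Type} [Field F] [NumberField F] (X : PilotData F) {logv : PadicLogs F} (hlog : LogvAnalytic logv)
  (M : Type) [Field M] [NumberField M]
  (archPk : ∀ (j : (thetaIndex X).Label) (vQ : (thetaIndex X).VQ), Set ((logShellsDH X logv).Packet j vQ))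
  (archSub : ∀ (j : (thetaIndex X).Label) (v : (thetaIndex X).V),
    Set ((logShellsDH X logv).Packet j ((thetaIndex X).over v)))
  (Ψ : ℤ → ∀ v : (thetaIndex X).V, v ∈ (thetaIndex X).Vbad → Set ((logShellsDH X logv).StarPacket v))
  (act : ℤ → ∀ v : (thetaIndex X).V, v ∈ (thetaIndex X).Vbad →
    (logShellsDH X logv).StarPacket v → Module.End ℚ ((logShellsDH X logv).StarPacket v))
  (Mmod : ℤ → ∀ j : (thetaIndex X).LabelStar, Set ((logShellsDH X logv).GlobalPacket j.1))
  (region : ℤ → ∀ j : (thetaIndex X).LabelStar, FinDivisor M → ∀ vQ : (thetaIndex X).VQ,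
    Set ((logShellsDH X logv).Packet j.1 vQ))
  (n : ℤ) {HT : Type} {LogLink : HT → HT → Type} {IsFull : ∀ {s t : HT}, LogLink s t → Prop}
  (lat : LGPGaussianLogThetaLattice LogLink IsFull)
  {Frd : Type} {IsoF : Frd → Frd → Type} {Ob : Frd → Type} {realify : Frd → Frd} {Strip : Type}
  {IsoS : Strip → Strip → Type} {Mv : ∀ v : (thetaIndex X).V, v ∈ (thetaIndex X).Vbad → Type}
  [∀ v h, Monoid (Mv v h)]
  (sig : GlobalLGPFrobenioidSignature (thetaIndex X).lstar (thetaIndex X).V (· ∈ (thetaIndex X).Vbad)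
    Frd IsoF Ob realify Strip IsoS Mv)
  (split : SplittingMonoids Mv) {ObΔ : Type} {N : ∀ v : (thetaIndex X).V, v ∈ (thetaIndex X).Vbad → Type}
  [∀ v h, Monoid (N v h)] (qData : QPilotData ObΔ N)

/-! ## §1. At `settingPrVol`: `LogvolMono`, `ThetaRegionsAdm` ⟸ hull-set boxes, Statement ⟸ the B-INPUT -/

section Generic

variable (thetaBox : ℤ → Ob sig.Clgp → ∀ (j : (thetaIndex X).Label) (vQ : (thetaIndex X).VQ),
    Set (∀ s : factorIdxDH X hlog j vQ, factorFieldDH X hlog j vQ s))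
  (qCentre : ObΔ → ∀ (j : (thetaIndex X).Label) (vQ : (thetaIndex X).VQ),
    ∀ s : factorIdxDH X hlog j vQ, factorFieldDH X hlog j vQ s)
  (hq : ∀ j vQ s, qCentre (qPilotObject qData) j vQ s ≠ 0)
  (hfin : ∀ j : (thetaIndex X).Label, (Function.support fun vQ =>
    ((situationPrVol X hlog M archPk archSub Ψ act Mmod region).D n).logvol j vQ
      (factorMapDH X hlog j vQ ⁻¹' hullSet (factorFieldDH X hlog j vQ) (qCentre (qPilotObject qData) j vQ))).Finite)

/-- **`LogvolMono` PROVED for the packet-normalised assembled real setting** ([IUTchIII] Prop. 3.9 (i): nonnegative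
weights, factorwise monotone log-measures; abc-iut-c312-5 `SummandPieces.logvolMono_of_realizes` on abc-iut-c312-1
`realizes_situationPrVol`). [claim: Mochizuki2012, status: disputed] -/
theorem logvolMono_settingPrVol :
    LogvolMono (settingPrVol X hlog M archPk archSub Ψ act Mmod region n lat sig split qData thetaBox qCentre hq hfin) :=
  SummandPieces.logvolMono_of_realizes (realizes_situationPrVol X hlog M archPk archSub Ψ act Mmod region _)

/-- **`ThetaRegionsAdm` at `settingPrVol` from the shape of the Θ-boxes**: hull-set boxes `λ·𝒪_L` pull back to admissible
regions of the packet-normalised container (abc-iut-c312-1 `hadm_Pr`; [IUTchIII] Rmk. 3.9.5 (ii)/(ix); abc-iut-c312-6's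
generic `thetaRegionsAdm_ofComparison_of_isHullSet`). [claim: Mochizuki2012, status: disputed] -/
theorem thetaRegionsAdm_settingPrVol_of_isHullSet
    (hbox : ∀ (m : ℤ) (i : Fin (thetaIndex X).lstar) (vQ : (thetaIndex X).VQ),
      IsHullSet (factorFieldDH X hlog _ vQ) (thetaBox m (thetaPilotObject sig split) (Setting.labelSucc i) vQ)) :
    ThetaRegionsAdm (settingPrVol X hlog M archPk archSub Ψ act Mmod region n lat sig split qData thetaBox qCentre hq
      hfin) :=
  thetaRegionsAdm_ofComparison_of_isHullSet n lat sig split qData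
    (realPiecesPr X hlog M archPk archSub Ψ act Mmod region thetaBox qCentre) hq
    (hadm_Pr X hlog M archPk archSub Ψ act Mmod region n) hfin hbox

/-- **The printed Statement of [IUTchIII] Cor. 3.12 at `settingPrVol` ⟸ {hull-set Θ-boxes, `ThetaFinite`, TEAM B's GLOBAL
gap input `GlobalVolumeTransport`}** (G-c312-11-1, kurims p. 184 l. 30–34 — NOT asserted; abc-iut-c312-6's
`statement_of_globalVolumeTransport_of_mono`). Twin of `Real.statement_settingDHVol_of_globalVolumeTransport`, now at the
PRINT-NORMALISED volumes. [claim: Mochizuki2012, status: disputed] -/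
theorem statement_settingPrVol_of_globalVolumeTransport
    (hbox : ∀ (m : ℤ) (i : Fin (thetaIndex X).lstar) (vQ : (thetaIndex X).VQ),
      IsHullSet (factorFieldDH X hlog _ vQ) (thetaBox m (thetaPilotObject sig split) (Setting.labelSucc i) vQ))
    (finite : (settingPrVol X hlog M archPk archSub Ψ act Mmod region n lat sig split qData thetaBox qCentre hq
      hfin).ThetaFinite)
    (hgvt : GlobalVolumeTransport (settingPrVol X hlog M archPk archSub Ψ act Mmod region n lat sig split qData thetaBox
      qCentre hq hfin)) :
    (settingPrVol X hlog M archPk archSub Ψ act Mmod region n lat sig split qData thetaBox qCentre hq hfin).Statement :=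
  statement_of_globalVolumeTransport_of_mono
    (logvolMono_settingPrVol X hlog M archPk archSub Ψ act Mmod region n lat sig split qData thetaBox qCentre hq hfin)
    finite
    (thetaRegionsAdm_settingPrVol_of_isHullSet X hlog M archPk archSub Ψ act Mmod region n lat sig split qData thetaBox
      qCentre hq hfin hbox)
    hgvt

/-- … and from the PER-PACKET B-INPUT `VolumeTransport` (abc-iut-c312-6's `statement_of_volumeTransport_of_mono`).
[claim: Mochizuki2012, status: disputed] -/
theorem statement_settingPrVol_of_volumeTransport
    (hbox : ∀ (m : ℤ) (i : Fin (thetaIndex X).lstar) (vQ : (thetaIndex X).VQ),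
      IsHullSet (factorFieldDH X hlog _ vQ) (thetaBox m (thetaPilotObject sig split) (Setting.labelSucc i) vQ))
    (finite : (settingPrVol X hlog M archPk archSub Ψ act Mmod region n lat sig split qData thetaBox qCentre hq
      hfin).ThetaFinite)
    (hvt : VolumeTransport (settingPrVol X hlog M archPk archSub Ψ act Mmod region n lat sig split qData thetaBox qCentre
      hq hfin)) :
    (settingPrVol X hlog M archPk archSub Ψ act Mmod region n lat sig split qData thetaBox qCentre hq hfin).Statement :=
  statement_of_volumeTransport_of_mono
    (logvolMono_settingPrVol X hlog M archPk archSub Ψ act Mmod region n lat sig split qData thetaBox qCentre hq hfin)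
    finite
    (thetaRegionsAdm_settingPrVol_of_isHullSet X hlog M archPk archSub Ψ act Mmod region n lat sig split qData thetaBox
      qCentre hq hfin hbox)
    hvt

end Generic

/-! ## §2. At `settingPrVolSharp`: `ThetaFinite` and `BridgeHyps` UNCONDITIONALLY; `ThetaRegionsAdm`; Statement ⟸ GVT -/

section Sharp

variable (t : ∀ (pp : Nat.Primes) (_ : Fin X.lstar) (x : (thetaIndex X).Fibre (.inr pp)),
    haveI : Fact (pp : ℕ).Prime := ⟨pp.2⟩; kOf X pp.1 x)
  (tq : ∀ (pp : Nat.Primes) (x : (thetaIndex X).Fibre (.inr pp)), haveI : Fact (pp : ℕ).Prime := ⟨pp.2⟩; kOf X pp.1 x)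

/-- **"`−|log(Θ)| ∈ ℝ`" for `settingPrVolSharp`** (`ThetaFinite`, the first clause of Cor. 3.12, kurims p. 174 l. 16):
this seat's `thetaFinite_settingPrVol` with its three box conditions DISCHARGED for the sharp boxes — bounded and
non-degenerate because the box is the hull-set `λ_Θ·𝒪_L` (abc-iut-c312-3 `isHullSet_thetaBoxDH_sharp`), equal to `𝒪_L` off
the primes under `S` (`finite_ne_unitBox_sharp`). [claim: Mochizuki2012, status: disputed] -/
theorem thetaFinite_settingPrVolSharp (ht0 : ∀ pp i x, t pp i x ≠ 0)
    (ht1 : ∀ (pp : Nat.Primes) (i : Fin X.lstar) (x : (thetaIndex X).Fibre (.inr pp)),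
      haveI : Fact (pp : ℕ).Prime := ⟨pp.2⟩; placeOf X pp.1 x ∉ X.S → ‖t pp i x‖ = 1)
    (htq0 : ∀ pp x, tq pp x ≠ 0)
    (htq1 : ∀ (pp : Nat.Primes) (x : (thetaIndex X).Fibre (.inr pp)),
      haveI : Fact (pp : ℕ).Prime := ⟨pp.2⟩; placeOf X pp.1 x ∉ X.S → ‖tq pp x‖ = 1) :
    (settingPrVolSharp X hlog M archPk archSub Ψ act Mmod region n lat sig split qData tq t htq0 htq1).ThetaFinite := by
  refine thetaFinite_settingPrVol X hlog M archPk archSub Ψ act Mmod region n lat sig split qData _ _ _ _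
    (fun i pp => ?_) (fun i pp => ?_) (fun i => ?_)
  · rw [iUnion_thetaBoxDH_sharp]
    exact (isHullSet_thetaBoxDH_sharp X hlog t ht0 (Setting.labelSucc i) (.inr pp)).isBounded
  · rw [iUnion_thetaBoxDH_sharp]
    exact (isHullSet_thetaBoxDH_sharp X hlog t ht0 (Setting.labelSucc i) (.inr pp)).isNondegenerate
  · refine (finite_ne_unitBox_sharp X hlog t ht0 ht1 i).subset fun pp hpp => ?_
    rwa [Set.mem_setOf_eq, iUnion_thetaBoxDH_sharp] at hpp

/-- **abc-iut-c312-6's `BridgeHyps` for the print-normalised real setting with the sharp Dupuy–Hilado pilot regions —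
EVERY FIELD A THEOREM** (mono, image_adm, image_fin, hul_nonempty, theta_nonempty by abc-iut-c312-1 `bridgeHyps_settingPrVol`;
hθ, hfinθ, hq, hfin by `Cor312PilotIdelesPr`; `ThetaFinite` by `thetaFinite_settingPrVolSharp`). Left: only the idele
binders (Θ-ideles and `q`-ideles non-zero and units off `S`: consequences of realising `P_Θ`, `P_q`, abc-iut-c312-3
`norm_eq_one_of_realises`; inhabited: `exists_realising_thetaIdeles` / `_qIdeles`). [claim: Mochizuki2012, status: disputed] -/
theorem bridgeHyps_settingPrVolSharp_of_ideles (ht0 : ∀ pp i x, t pp i x ≠ 0)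
    (ht1 : ∀ (pp : Nat.Primes) (i : Fin X.lstar) (x : (thetaIndex X).Fibre (.inr pp)),
      haveI : Fact (pp : ℕ).Prime := ⟨pp.2⟩; placeOf X pp.1 x ∉ X.S → ‖t pp i x‖ = 1)
    (htq0 : ∀ pp x, tq pp x ≠ 0)
    (htq1 : ∀ (pp : Nat.Primes) (x : (thetaIndex X).Fibre (.inr pp)),
      haveI : Fact (pp : ℕ).Prime := ⟨pp.2⟩; placeOf X pp.1 x ∉ X.S → ‖tq pp x‖ = 1) :
    BridgeHyps (settingPrVolSharp X hlog M archPk archSub Ψ act Mmod region n lat sig split qData tq t htq0 htq1) :=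
  bridgeHyps_settingPrVolSharp X hlog M archPk archSub Ψ act Mmod region n lat sig split qData tq t ht0 ht1 htq0 htq1
    (thetaFinite_settingPrVolSharp X hlog M archPk archSub Ψ act Mmod region n lat sig split qData t tq ht0 ht1 htq0 htq1)

/-- **abc-iut-c312-11's `ThetaRegionsAdm` for `settingPrVolSharp`** — every `(n, m)`-Kummer image of the Θ-pilot object is
admissible in the packet-normalised container (each is the preimage of the hull-set `λ_Θ·𝒪_L`).
[claim: Mochizuki2012, status: disputed] -/
theorem thetaRegionsAdm_settingPrVolSharp (ht0 : ∀ pp i x, t pp i x ≠ 0) (htq0 : ∀ pp x, tq pp x ≠ 0)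
    (htq1 : ∀ (pp : Nat.Primes) (x : (thetaIndex X).Fibre (.inr pp)),
      haveI : Fact (pp : ℕ).Prime := ⟨pp.2⟩; placeOf X pp.1 x ∉ X.S → ‖tq pp x‖ = 1) :
    ThetaRegionsAdm (settingPrVolSharp X hlog M archPk archSub Ψ act Mmod region n lat sig split qData tq t htq0 htq1) :=
  thetaRegionsAdm_settingPrVol_of_isHullSet X hlog M archPk archSub Ψ act Mmod region n lat sig split qData _ _ _ _
    fun _ i vQ => isHullSet_thetaBoxDH_sharp X hlog t ht0 (Setting.labelSucc i) vQ

/-- **The printed `Statement` of [IUTchIII] Cor. 3.12 for `settingPrVolSharp` ⟸ TEAM B's gap input `GlobalVolumeTransport`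
ALONE** (G-c312-11-1, kurims p. 184 l. 30–34 — NOT asserted): the side conditions (hull-set Θ-boxes, `ThetaFinite`)
DISCHARGED for the print-normalised real Dupuy–Hilado setting with pilot regions read off ideles; twin of abc-iut-c312-3's
`statement_settingDHVolSharp_of_globalVolumeTransport`. [claim: Mochizuki2012, status: disputed] -/
theorem statement_settingPrVolSharp_of_globalVolumeTransport (ht0 : ∀ pp i x, t pp i x ≠ 0)
    (ht1 : ∀ (pp : Nat.Primes) (i : Fin X.lstar) (x : (thetaIndex X).Fibre (.inr pp)),
      haveI : Fact (pp : ℕ).Prime := ⟨pp.2⟩; placeOf X pp.1 x ∉ X.S → ‖t pp i x‖ = 1)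
    (htq0 : ∀ pp x, tq pp x ≠ 0)
    (htq1 : ∀ (pp : Nat.Primes) (x : (thetaIndex X).Fibre (.inr pp)),
      haveI : Fact (pp : ℕ).Prime := ⟨pp.2⟩; placeOf X pp.1 x ∉ X.S → ‖tq pp x‖ = 1)
    (hgvt : GlobalVolumeTransport
      (settingPrVolSharp X hlog M archPk archSub Ψ act Mmod region n lat sig split qData tq t htq0 htq1)) :
    (settingPrVolSharp X hlog M archPk archSub Ψ act Mmod region n lat sig split qData tq t htq0 htq1).Statement :=
  statement_settingPrVol_of_globalVolumeTransport X hlog M archPk archSub Ψ act Mmod region n lat sig split qData _ _ _ _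
    (fun _ i vQ => isHullSet_thetaBoxDH_sharp X hlog t ht0 (Setting.labelSucc i) vQ)
    (thetaFinite_settingPrVolSharp X hlog M archPk archSub Ψ act Mmod region n lat sig split qData t tq ht0 ht1 htq0 htq1)
    hgvt

/-! ## §3. The numbers at `settingPrVolSharp` and the residue of the Statement -/

/-- **`−|log(q)| = −deĝ(P_q)` for `settingPrVolSharp`** with `q`-ideles realising `P_q` in Dupuy–Hilado's normalisation
(3.4) (`Cor312PilotIdelesPrNumbers.negLogQ_settingPrVol_qCentreDH`, the Θ-boxes being the sharp ones).
[cite: DupuyHilado2025, §3.4, Thm. 3.10.1] -/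
theorem negLogQ_settingPrVolSharp (htq0 : ∀ pp x, tq pp x ≠ 0)
    (htq1 : ∀ (pp : Nat.Primes) (x : (thetaIndex X).Fibre (.inr pp)),
      haveI : Fact (pp : ℕ).Prime := ⟨pp.2⟩; placeOf X pp.1 x ∉ X.S → ‖tq pp x‖ = 1)
    (htq : ∀ (pp : Nat.Primes) (x : (thetaIndex X).Fibre (.inr pp)),
      haveI : Fact (pp : ℕ).Prime := ⟨pp.2⟩
      Real.log ‖tq pp x‖ = -(X.qPilot (placeOf X pp.1 x)) * logNorm F (placeOf X pp.1 x) /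
        localDegree F (placeOf X pp.1 x)) :
    (settingPrVolSharp X hlog M archPk archSub Ψ act Mmod region n lat sig split qData tq t htq0 htq1).negLogQ =
      -FinDivisor.ndeg F X.qPilot :=
  negLogQ_settingPrVol_qCentreDH X hlog M archPk archSub Ψ act Mmod region n lat sig split qData _ tq htq0 _ htq

/-- **`−|log(q)| = −(1/2l)·log(q)` of the initial Θ-data for `settingPrVolSharp`** ([IUTchIV] Thm. 1.10 p. 23 l. 27–30),
under abc-iut-c312-8's provenance link `IsPilotDataOf D X` — the field `IsSettingOf.negLogQ_eq` DISCHARGED here.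
[claim: Mochizuki2012, status: disputed] -/
theorem negLogQ_settingPrVolSharp_eq_neg_absLogq {K Fbar : Type} [Field K] [NumberField K] [Algebra F K] [Field Fbar]
    [Algebra F Fbar] [Algebra K Fbar] {E : WeierstrassCurve F} [E.IsElliptic] {l : ℕ} {Pb : BadPlacePredicates K}
    {D : InitialThetaData F K Fbar E l Pb} (hX : Cor312Prov.IsPilotDataOf D X) (htq0 : ∀ pp x, tq pp x ≠ 0)
    (htq1 : ∀ (pp : Nat.Primes) (x : (thetaIndex X).Fibre (.inr pp)),
      haveI : Fact (pp : ℕ).Prime := ⟨pp.2⟩; placeOf X pp.1 x ∉ X.S → ‖tq pp x‖ = 1)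
    (htq : ∀ (pp : Nat.Primes) (x : (thetaIndex X).Fibre (.inr pp)),
      haveI : Fact (pp : ℕ).Prime := ⟨pp.2⟩
      Real.log ‖tq pp x‖ = -(X.qPilot (placeOf X pp.1 x)) * logNorm F (placeOf X pp.1 x) /
        localDegree F (placeOf X pp.1 x)) :
    (settingPrVolSharp X hlog M archPk archSub Ψ act Mmod region n lat sig split qData tq t htq0 htq1).negLogQ =
      -Cor312Prov.absLogq D :=
  negLogQ_settingPrVol_eq_neg_absLogq X hlog M archPk archSub Ψ act Mmod region n lat sig split qData _ tq htq0 _ htq hX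

/-- **"`|log(q)| > 0`"** for `settingPrVolSharp` with realising `q`-ideles (`deĝ(P_q) > 0`). [claim: Mochizuki2012, status: disputed] -/
theorem absLogQPos_settingPrVolSharp (htq0 : ∀ pp x, tq pp x ≠ 0)
    (htq1 : ∀ (pp : Nat.Primes) (x : (thetaIndex X).Fibre (.inr pp)),
      haveI : Fact (pp : ℕ).Prime := ⟨pp.2⟩; placeOf X pp.1 x ∉ X.S → ‖tq pp x‖ = 1)
    (htq : ∀ (pp : Nat.Primes) (x : (thetaIndex X).Fibre (.inr pp)),
      haveI : Fact (pp : ℕ).Prime := ⟨pp.2⟩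
      Real.log ‖tq pp x‖ = -(X.qPilot (placeOf X pp.1 x)) * logNorm F (placeOf X pp.1 x) /
        localDegree F (placeOf X pp.1 x)) :
    (settingPrVolSharp X hlog M archPk archSub Ψ act Mmod region n lat sig split qData tq t htq0 htq1).AbsLogQPos :=
  absLogQPos_settingPrVol_qCentreDH X hlog M archPk archSub Ψ act Mmod region n lat sig split qData _ tq htq0 _ htq

/-- **THE RESIDUE OF THE PRINTED STATEMENT at the print-normalised assembled real setting with pilot regions read off
realising ideles**: `Statement ↔ ↑(−deĝ(P_q)) ≤ −|log(Θ)|` — the first conjunct "`−|log(Θ)| ∈ ℝ`" is a THEOREM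
(`thetaFinite_settingPrVolSharp`), the `q`-side is the NUMBER `−deĝ(P_q)` (`negLogQ_settingPrVolSharp`); what remains of
[IUTchIII] Cor. 3.12 here is exactly the Θ-side inequality — the cell's adjudication question (plan/ADJUDICATION-SPEC; e.g.
⟸ `GlobalVolumeTransport`, §2), NOT asserted and NOT denied by this file. [claim: Mochizuki2012, status: disputed] -/
theorem statement_settingPrVolSharp_iff (ht0 : ∀ pp i x, t pp i x ≠ 0)
    (ht1 : ∀ (pp : Nat.Primes) (i : Fin X.lstar) (x : (thetaIndex X).Fibre (.inr pp)),
      haveI : Fact (pp : ℕ).Prime := ⟨pp.2⟩; placeOf X pp.1 x ∉ X.S → ‖t pp i x‖ = 1)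
    (htq0 : ∀ pp x, tq pp x ≠ 0)
    (htq1 : ∀ (pp : Nat.Primes) (x : (thetaIndex X).Fibre (.inr pp)),
      haveI : Fact (pp : ℕ).Prime := ⟨pp.2⟩; placeOf X pp.1 x ∉ X.S → ‖tq pp x‖ = 1)
    (htq : ∀ (pp : Nat.Primes) (x : (thetaIndex X).Fibre (.inr pp)),
      haveI : Fact (pp : ℕ).Prime := ⟨pp.2⟩
      Real.log ‖tq pp x‖ = -(X.qPilot (placeOf X pp.1 x)) * logNorm F (placeOf X pp.1 x) /
        localDegree F (placeOf X pp.1 x)) :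
    (settingPrVolSharp X hlog M archPk archSub Ψ act Mmod region n lat sig split qData tq t htq0 htq1).Statement ↔
      (((-FinDivisor.ndeg F X.qPilot : ℝ) : WithTop ℝ) ≤
        (settingPrVolSharp X hlog M archPk archSub Ψ act Mmod region n lat sig split qData tq t htq0 htq1).negLogTheta) := by
  have hfin := thetaFinite_settingPrVolSharp X hlog M archPk archSub Ψ act Mmod region n lat sig split qData t tq ht0 ht1
    htq0 htq1
  have hne : (settingPrVolSharp X hlog M archPk archSub Ψ act Mmod region n lat sig split qData tq t htq0
      htq1).negLogTheta ≠ ⊤ := by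
    unfold Setting.negLogTheta
    rw [if_pos hfin]
    exact WithTop.coe_ne_top
  unfold Setting.Statement
  rw [negLogQ_settingPrVolSharp X hlog M archPk archSub Ψ act Mmod region n lat sig split qData t tq htq0 htq1 htq]
  exact ⟨fun h => h.2, fun h => ⟨hne, h⟩⟩

end Sharp

end Real

end Thm311

end IUTFork

end Summit.ABC

end
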